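import Summits.Ventures.Crystal3D.Theorems.StickyWulffConstantNoReconstructionGainCertificate
import HarnessLib

/-!
# Four-family Barlow films: the per-lattice-ball count is a clique rule

HONEST FRAMING. Part of the venture `Summits/Ventures/Crystal3D` (cell `crystal3d-full`), helper
`--supports` the crux `NoReconstructionGain` (stmt-Ventures-19144, route
`route-Ventures-StickyWulffConstant`), line `adhesion`; first Lean piece of census class (ii) (films on
the Barlow positions `Λ₀ + {0, ±w_f}` of all four `{111}` families).  lead folder RUNGS-g9b.md §2.

A lattice ball of such a film has its partners among 36 directions: the 12 kissing vectors
(cuboctahedron vertices) and 24 twin vectors `(2e_j + 2e_k − e_i)/3` (one per cuboctahedron EDGE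
`{e_j, e_k}`, `{e_i, e_j, e_k}` a triangular face).  For `ν` in the fundamental chamber of the cube group
(cubic components `a₁ > a₂ > a₃ > 0`) the four-family transfer recipe makes exactly 18 of them cost `2`:
the 6 `ν`-negative kissing vectors and 12 twin vectors; and these 18 split into SIX TRIPLES
`{h, t, t'}` (a negative kissing vector `h` and the two cost-2 twins of ONE square at `h`) that are
pairwise closer than `1` — so a ball has at most one partner per triple, at most 6 partners of cost 2,
and the per-ball inequality `hT2` of `adhesion_of_flow` holds with no enumeration (the exhaustive check
over the 72 `ν`-types, kit j296239, found this certificate to be forced and type-independent modulo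
the cube group).

* `cliqueRule_T2` — ABSTRACT per-ball count: if the plug directions and the film directions of
  transfer `> −1` all lie in at most six lists of pairwise-conflicting vectors, then
  `#plugs(q) + Σ t(x,q) ≤ 12 − deg(q)`.
* `barlowPos_zlin`, `barlowPos_normSq` — integer linearity and the norm form of fcc labels.
* `fourFamilyChamber_cliques` — the six explicit triples in the tree frame (heads = the kissing
  vectors `u − v`, `−(N+w)`, `−u`, `−(N+w−v)`, `−v`, `−(N+w−u)` written as in the closure list;
  twins as `(1/3) • barlowPos K I J`, i.e. `(2e_j + 2e_k − e_i)/3`) are pairwise at distance `< 1`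
  (`|t − h|² = 1/3`, `|t − t'|² = 2/9`).  The chamber is the one whose negative kissing vectors are
  these six heads (cubic frame: `(1,1,1) ↦ e₃`, `(0,1,−1) ↦ u`, `(1,0,−1) ↦ v`, `(1,1,0) ↦ N + w`).

WHAT THIS IS NOT: the direction lemma for four-family films, the twin-ball count for tilted families,
the assembly (`adhesion_of_flow` + rim + cube-group transport) — RUNGS-g9b.md L2–L4; F-C1 not moved.
-/

noncomputable section

namespace Summit.Ventures.Crystal3D.Theorems

open Summit.Ventures.Crystal3D Finset
open Literature.MathematicalPhysics.StatisticalMechanics (barlowPos barlowOffset layerNormal constHagg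
  haggLabel_const barlowPos_apply_zero barlowPos_apply_one barlowPos_apply_two triangularVec₁ triangularVec₂)
open scoped InnerProductSpace

/-- **Abstract clique rule.**  `q` a film ball of a finite unit packing `X ⊇ P`, `t` a transfer with
`t ≤ 1`; `K` at most six lists of pairwise-conflicting vectors (distance `< 1`) such that every plug
direction `p − q` lies in some list of `K` and every film partner whose direction lies in no list has
`t ≤ −1`.  Then `#plugs(q) + Σ_{film partners} t(x, q) ≤ 12 − deg(q)`. -/
theorem cliqueRule_T2 (X P : Finset (EuclideanSpace ℝ (Fin 3)))
    (hX : ∀ p ∈ X, ∀ q ∈ X, p ≠ q → 1 ≤ dist p q) (hPX : P ⊆ X)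
    (q : EuclideanSpace ℝ (Fin 3)) (t : EuclideanSpace ℝ (Fin 3) → EuclideanSpace ℝ (Fin 3) → ℤ)
    (ht_le : ∀ x, t x q ≤ 1)
    (K : List (List (EuclideanSpace ℝ (Fin 3)))) (hK : K.length ≤ 6)
    (hKconf : ∀ k ∈ K, ∀ d ∈ k, ∀ d' ∈ k, d ≠ d' → dist d d' < 1)
    (hplug : ∀ p ∈ P, dist q p = 1 → ∃ k ∈ K, p - q ∈ k)
    (ht_zero : ∀ x ∈ X \ P, dist q x = 1 → (∀ k ∈ K, x - q ∉ k) → t x q ≤ -1) :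
    ((P.filter fun p => dist q p = 1).card : ℤ)
        + ∑ x ∈ (X \ P).filter (fun x => dist q x = 1), t x q
      ≤ 12 - ((X.filter fun x => dist q x = 1).card : ℤ) := by
  classical
  set S := X.filter fun x => dist q x = 1 with hS
  set Sp := P.filter fun p => dist q p = 1 with hSp
  set Sf := (X \ P).filter fun x => dist q x = 1 with hSf
  have hsplit : S.card = Sp.card + Sf.card := card_partners_eq_plug_add_film X P hPX q
  -- partners whose direction lies in a clique: at most one per clique, hence at most six
  set C := S.filter fun x => ∃ k ∈ K, x - q ∈ k with hC
  have hone : ∀ k ∈ K, (S.filter fun x => x - q ∈ k).card ≤ 1 := by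
    intro k hk
    refine card_le_one.2 fun x hx y hy => ?_
    obtain ⟨hxS, hxk⟩ := mem_filter.1 hx
    obtain ⟨hyS, hyk⟩ := mem_filter.1 hy
    by_contra hne
    have h1 : 1 ≤ dist x y := hX x (mem_filter.1 hxS).1 y (mem_filter.1 hyS).1 hne
    have h2 : dist (x - q) (y - q) < 1 := hKconf k hk _ hxk _ hyk (fun h => hne (sub_left_injective h))
    rw [dist_eq_norm, show x - q - (y - q) = x - y by abel, ← dist_eq_norm] at h2
    linarith
  have hCle : C.card ≤ 6 := by
    have hsub : C ⊆ K.toFinset.biUnion fun k => S.filter fun x => x - q ∈ k := by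
      intro x hx
      obtain ⟨hxS, k, hk, hxk⟩ := mem_filter.1 hx
      exact mem_biUnion.2 ⟨k, List.mem_toFinset.2 hk, mem_filter.2 ⟨hxS, hxk⟩⟩
    calc C.card ≤ (K.toFinset.biUnion fun k => S.filter fun x => x - q ∈ k).card := card_le_card hsub
      _ ≤ ∑ k ∈ K.toFinset, (S.filter fun x => x - q ∈ k).card := card_biUnion_le
      _ ≤ ∑ k ∈ K.toFinset, 1 := sum_le_sum fun k hk => hone k (List.mem_toFinset.1 hk)
      _ = K.toFinset.card := by simp
      _ ≤ K.length := List.toFinset_card_le K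
      _ ≤ 6 := hK
  -- plugs and clique film partners are disjoint parts of `C`
  set Cf := Sf.filter fun x => ∃ k ∈ K, x - q ∈ k with hCf
  have hSpC : Sp ⊆ C := by
    intro p hp
    obtain ⟨hpP, hd⟩ := mem_filter.1 hp
    exact mem_filter.2 ⟨mem_filter.2 ⟨hPX hpP, hd⟩, hplug p hpP hd⟩
  have hCfC : Cf ⊆ C := by
    intro x hx
    obtain ⟨hxSf, hk⟩ := mem_filter.1 hx
    obtain ⟨hxXP, hd⟩ := mem_filter.1 hxSf
    exact mem_filter.2 ⟨mem_filter.2 ⟨(mem_sdiff.1 hxXP).1, hd⟩, hk⟩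
  have hdisj : Disjoint Sp Cf := by
    rw [disjoint_left]
    intro x hx hx'
    exact (mem_sdiff.1 (mem_filter.1 (mem_filter.1 hx').1).1).2 (mem_filter.1 hx).1
  have hsum6 : Sp.card + Cf.card ≤ 6 := by
    rw [← card_union_of_disjoint hdisj]
    exact (card_le_card (union_subset hSpC hCfC)).trans hCle
  -- the transfer sum
  have hT : ∑ x ∈ Sf, t x q ≤ (Cf.card : ℤ) - ((Sf.card : ℤ) - Cf.card) := by
    rw [← sum_filter_add_sum_filter_not Sf (fun x => ∃ k ∈ K, x - q ∈ k)]
    have h1 : ∑ x ∈ Cf, t x q ≤ ∑ x ∈ Cf, (1 : ℤ) := sum_le_sum fun x _ => ht_le x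
    have h2 : ∑ x ∈ Sf.filter (fun x => ¬ ∃ k ∈ K, x - q ∈ k), t x q ≤
        ∑ x ∈ Sf.filter (fun x => ¬ ∃ k ∈ K, x - q ∈ k), (-1 : ℤ) := by
      refine sum_le_sum fun x hx => ?_
      obtain ⟨hxSf, hno⟩ := mem_filter.1 hx
      obtain ⟨hxXP, hd⟩ := mem_filter.1 hxSf
      push Not at hno
      exact ht_zero x hxXP hd hno
    simp only [sum_const, nsmul_eq_mul, mul_one] at h1
    simp only [sum_const, nsmul_eq_mul, mul_neg, mul_one] at h2
    have h3 : ((Sf.filter fun x => ¬ ∃ k ∈ K, x - q ∈ k).card : ℤ) = Sf.card - Cf.card := by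
      have := card_filter_add_card_filter_not (s := Sf) (fun x => ∃ k ∈ K, x - q ∈ k)
      rw [hCf]; omega
    rw [h3] at h2
    rw [← hCf]
    linarith
  have h6 : (Sp.card : ℤ) + Cf.card ≤ 6 := by exact_mod_cast hsum6
  have hs : (S.card : ℤ) = Sp.card + Sf.card := by exact_mod_cast hsplit
  rw [hs]
  linarith

/-- Integer linearity of the fcc labels: `a • pos L + b • pos L' = pos (a L + b L')`. -/
theorem barlowPos_zlin (a b k i j k' i' j' : ℤ) :
    (a : ℝ) • barlowPos 1 (Real.sqrt (2 / 3)) constHagg k i j + (b : ℝ) • barlowPos 1 (Real.sqrt (2 / 3)) constHagg k' i' j' =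
      barlowPos 1 (Real.sqrt (2 / 3)) constHagg (a * k + b * k') (a * i + b * i') (a * j + b * j') := by
  ext m
  fin_cases m <;> simp [PiLp.add_apply, PiLp.smul_apply] <;> ring

/-- The norm form of an fcc label (unit nearest-neighbour distance). -/
theorem barlowPos_normSq (k i j : ℤ) :
    ‖barlowPos 1 (Real.sqrt (2 / 3)) constHagg k i j‖ ^ 2 = ((i : ℝ) + j / 2 + k / 2) ^ 2 + 3 / 4 * ((j : ℝ) + k / 3) ^ 2 + 2 / 3 * (k : ℝ) ^ 2 := by
  have h3 : Real.sqrt 3 ^ 2 = 3 := Real.sq_sqrt (by norm_num)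
  have hh : Real.sqrt (2 / 3) ^ 2 = 2 / 3 := Real.sq_sqrt (by norm_num)
  rw [EuclideanSpace.real_norm_sq_eq, Fin.sum_univ_three]
  simp only [barlowPos_apply_zero, barlowPos_apply_one, barlowPos_apply_two, haggLabel_const, one_mul]
  linear_combination ((j : ℝ) + k / 3) ^ 2 / 4 * h3 + (k : ℝ) ^ 2 * hh

/-- Distance of `(1/3) • pos L` from `pos l`, and between two thirds, via one label each. -/
theorem third_dist_sq (K I J k i j : ℤ) :
    dist ((1 / 3 : ℝ) • barlowPos 1 (Real.sqrt (2 / 3)) constHagg K I J) (barlowPos 1 (Real.sqrt (2 / 3)) constHagg k i j) ^ 2 =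
      (1 / 9) * (((I - 3 * i : ℤ) : ℝ) + ((J - 3 * j : ℤ) : ℝ) / 2 + ((K - 3 * k : ℤ) : ℝ) / 2) ^ 2
        + (1 / 9) * (3 / 4 * (((J - 3 * j : ℤ) : ℝ) + ((K - 3 * k : ℤ) : ℝ) / 3) ^ 2)
        + (1 / 9) * (2 / 3 * (((K - 3 * k : ℤ) : ℝ)) ^ 2) := by
  have e : (1 / 3 : ℝ) • barlowPos 1 (Real.sqrt (2 / 3)) constHagg K I J - barlowPos 1 (Real.sqrt (2 / 3)) constHagg k i j =
      (1 / 3 : ℝ) • barlowPos 1 (Real.sqrt (2 / 3)) constHagg (K - 3 * k) (I - 3 * i) (J - 3 * j) := by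
    have := barlowPos_zlin 1 (-3) K I J k i j
    simp only [Int.cast_one, one_smul, Int.cast_neg, Int.cast_ofNat, neg_smul, one_mul, neg_mul] at this
    rw [show (1 / 3 : ℝ) • barlowPos 1 (Real.sqrt (2 / 3)) constHagg K I J - barlowPos 1 (Real.sqrt (2 / 3)) constHagg k i j =
        (1 / 3 : ℝ) • (barlowPos 1 (Real.sqrt (2 / 3)) constHagg K I J - (3 : ℝ) • barlowPos 1 (Real.sqrt (2 / 3)) constHagg k i j) by rw [smul_sub, smul_smul]; norm_num,
      sub_eq_add_neg, this]
    congr 1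
  rw [dist_eq_norm, e, norm_smul, mul_pow, barlowPos_normSq, show ‖(1 / 3 : ℝ)‖ = 1 / 3 by norm_num]
  push_cast
  ring

/-- **The six conflict triples of the fundamental chamber** (tree frame).  Heads (the `ν`-negative
kissing vectors for `ν` in the chamber): `pos 0 1 (−1) = u − v`, `−pos 1 0 0 = −(N + w)`,
`−pos 0 1 0 = −u`, `pos (−1) 0 1 = −(N + w − v)`, `−pos 0 0 1 = −v`, `pos (−1) 1 0 = −(N + w − u)`; with
each, the two cost-2 twin vectors `(1/3) • pos K I J` of its square (cubic labels in RUNGS-g9b.md).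
Every two distinct members of a triple are at distance `< 1`. -/
theorem fourFamilyChamber_cliques :
    ∀ k ∈ ([[barlowPos 1 (Real.sqrt (2 / 3)) constHagg 0 1 (-1), (1 / 3 : ℝ) • barlowPos 1 (Real.sqrt (2 / 3)) constHagg (-1) 2 (-3), (1 / 3 : ℝ) • barlowPos 1 (Real.sqrt (2 / 3)) constHagg (-2) 3 (-2)],
      [-barlowPos 1 (Real.sqrt (2 / 3)) constHagg 1 0 0, (1 / 3 : ℝ) • barlowPos 1 (Real.sqrt (2 / 3)) constHagg (-2) 1 (-2), (1 / 3 : ℝ) • barlowPos 1 (Real.sqrt (2 / 3)) constHagg (-3) 2 (-1)],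
      [-barlowPos 1 (Real.sqrt (2 / 3)) constHagg 0 1 0, (1 / 3 : ℝ) • barlowPos 1 (Real.sqrt (2 / 3)) constHagg (-1) (-3) 2, (1 / 3 : ℝ) • barlowPos 1 (Real.sqrt (2 / 3)) constHagg (-2) (-2) 1],
      [barlowPos 1 (Real.sqrt (2 / 3)) constHagg (-1) 0 1, (1 / 3 : ℝ) • barlowPos 1 (Real.sqrt (2 / 3)) constHagg (-2) (-2) 3, (1 / 3 : ℝ) • barlowPos 1 (Real.sqrt (2 / 3)) constHagg (-3) (-1) 2],
      [-barlowPos 1 (Real.sqrt (2 / 3)) constHagg 0 0 1, (1 / 3 : ℝ) • barlowPos 1 (Real.sqrt (2 / 3)) constHagg 2 (-1) (-3), (1 / 3 : ℝ) • barlowPos 1 (Real.sqrt (2 / 3)) constHagg 1 (-2) (-2)],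
      [barlowPos 1 (Real.sqrt (2 / 3)) constHagg (-1) 1 0, (1 / 3 : ℝ) • barlowPos 1 (Real.sqrt (2 / 3)) constHagg (-2) 3 1, (1 / 3 : ℝ) • barlowPos 1 (Real.sqrt (2 / 3)) constHagg (-3) 2 2]] : List (List (EuclideanSpace ℝ (Fin 3)))),
      ∀ d ∈ k, ∀ d' ∈ k, d ≠ d' → dist d d' < 1 := by
  have hneg : ∀ k i j : ℤ, -barlowPos 1 (Real.sqrt (2 / 3)) constHagg k i j = barlowPos 1 (Real.sqrt (2 / 3)) constHagg (-k) (-i) (-j) := by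
    intro k i j
    have := barlowPos_zlin (-1) 0 k i j 0 0 0
    simp only [Int.cast_neg, Int.cast_one, neg_smul, one_smul, Int.cast_zero, zero_smul, add_zero,
      neg_mul, one_mul, mul_zero] at this
    simpa using this
  have hthird : ∀ K I J K' I' J' : ℤ, dist ((1 / 3 : ℝ) • barlowPos 1 (Real.sqrt (2 / 3)) constHagg K I J) ((1 / 3 : ℝ) • barlowPos 1 (Real.sqrt (2 / 3)) constHagg K' I' J') ^ 2 =
      (1 / 9) * ((((I - I' : ℤ) : ℝ) + ((J - J' : ℤ) : ℝ) / 2 + ((K - K' : ℤ) : ℝ) / 2) ^ 2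
        + 3 / 4 * (((J - J' : ℤ) : ℝ) + ((K - K' : ℤ) : ℝ) / 3) ^ 2 + 2 / 3 * (((K - K' : ℤ) : ℝ)) ^ 2) := by
    intro K I J K' I' J'
    have := barlowPos_zlin 1 (-1) K I J K' I' J'
    simp only [Int.cast_one, one_smul, Int.cast_neg, neg_smul, one_mul, neg_mul] at this
    rw [dist_eq_norm, ← smul_sub, sub_eq_add_neg, this, norm_smul, mul_pow, barlowPos_normSq,
      show ‖(1 / 3 : ℝ)‖ = 1 / 3 by norm_num]
    push_cast
    ring
  have lt_of_sq : ∀ x y : EuclideanSpace ℝ (Fin 3), dist x y ^ 2 < 1 → dist x y < 1 := fun x y h => by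
    nlinarith [dist_nonneg (x := x) (y := y)]
  intro k hk d hd d' hd' hne
  apply lt_of_sq
  simp only [List.mem_cons, List.mem_nil_iff, or_false] at hk
  rcases hk with rfl | rfl | rfl | rfl | rfl | rfl <;>
    simp only [List.mem_cons, List.mem_nil_iff, or_false] at hd hd' <;>
    rcases hd with rfl | rfl | rfl <;> rcases hd' with rfl | rfl | rfl <;>
    first
    | exact absurd rfl hne
    | (try rw [hneg]); (try rw [dist_comm ((1 / 3 : ℝ) • _) (barlowPos _ _ _ _ _ _)]);
      first
      | rw [dist_comm, third_dist_sq]; push_cast; norm_num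
      | rw [hthird]; push_cast; norm_num
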